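import Mathlib
import HarnessLib

/-!
# Two anticommuting reflections with a rotation of infinite order kill every polynomial
# (crux ⟨stmt-QuantumFields-23035⟩ `F4SubCurvatureDoor.ShortRootRigidity`, stub :146 `stub_oddModeRigidity`; §1 step (7) and the
# «pure-odd lemma» of the owner's paper proof `Cruxes/ShortRootRigidity/TrigonalInjectivity.md` (ym-idea-3 g21, 52ad35ad867d))

Let `σ₁`, `σ₂` be the reflections of `ℝ³` in the planes `(1,1,1)^⊥`, `(1,1,−1)^⊥` (the planes orthogonal to two body diagonals of the
cube; they meet along the 2-fold axis `(1,−1,0)` at the angle `arccos(1/3)`).  THEOREM (`eq_zero_of_odd_under_two_diagonal_reflections`):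
a polynomial `P ∈ ℝ[x₀,x₁,x₂]` with `P∘σ₁ = −P` and `P∘σ₂ = −P` (as functions) is ZERO.  No harmonicity, no cubic invariance, no degree
hypothesis.  In the paper proof this is exactly what is needed after `a = 0` (relations (R_d) become `Y∘σ_d = −Y`), and it also replaces the
«pure-odd lemma» (no density / irrational-rotation / Niven argument is needed).

PROOF (entirely rational).  `P∘σ₁ = −P` makes `P` vanish on `Π₁ = {x₀+x₁+x₂ = 0}`; `P∘(σ₁σ₂) = P` makes it vanish on every plane
`{n_k·x = 0}`, `n_k := (σ₂σ₁)^k (1,1,1)`.  In the basis `e_a = (1,1,0)`, `e_b = (0,0,1)` of `(1,−1,0)^⊥` one has `9^k n_k = A_k e_a + B_k e_b` with the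
INTEGER recurrence `(A, B)_{k+1} = (−7A + 4B, −8A − 7B)`, `(A, B)₀ = (1, 1)` (`sum_iterate_S`); the determinant identity
`A_{i+j}B_j − A_jB_{i+j} = 81^j (A_i − B_i)` (`det_identity`) and `A_i − B_i = 12 U_i` with `U₀ = 0, U₁ = 1, U_{m+2} = −14U_{m+1} − 81U_m`,
`U_m ≡ 1 (mod 3)` for `m ≥ 1`, show that the planes are pairwise distinct and that `A_k = A_{k+1} = 0` never happens.  For a point `x` with
`x₂ ≠ 0` the line `x + t(1,1,0)` meets plane `k` at `t_k = −(x₀+x₁)/2 − B_k x₂/(2A_k)` (`A_k ≠ 0`), pairwise distinct, so the univariate restriction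
of `P` has infinitely many roots and vanishes (`Polynomial.eq_zero_of_infinite_isRoot`); hence `P x = 0`; the plane `x₂ = 0` follows by
continuity, and `MvPolynomial.funext` concludes.

Mathlib only.  HONEST LABEL: a helper lemma toward the algebraic half of :146; `OddModeRigidity`, ⟨23035⟩, ⟨23125⟩, R2d and the Yang–Mills
mass gap remain OPEN; no summit is proved by a line. [folklore; arithmetic of the rational rotation `cos θ = −7/9`]
-/

noncomputable section

namespace Summit.QuantumFields.YangMills.Theorems.F4SubCurvatureDoorTwoReflections

open MvPolynomial Filter Topology

/-! ## The two reflections and their product -/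

/-- Reflection of `ℝ³` in the plane `(1,1,1)^⊥`: `x ↦ x − (2/3)(x₀+x₁+x₂)(1,1,1)`. -/
def σ₁ (x : Fin 3 → ℝ) : Fin 3 → ℝ := fun i => x i - 2 / 3 * (x 0 + x 1 + x 2)

/-- Reflection of `ℝ³` in the plane `(1,1,−1)^⊥`: `x ↦ x − (2/3)(x₀+x₁−x₂)(1,1,−1)`. -/
def σ₂ (x : Fin 3 → ℝ) : Fin 3 → ℝ := fun i => x i - 2 / 3 * (x 0 + x 1 - x 2) * (if i = 2 then -1 else 1)

/-- The rotation `S = σ₁ ∘ σ₂` (axis `(1,−1,0)`, `cos θ = −7/9`). -/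
def S (x : Fin 3 → ℝ) : Fin 3 → ℝ := σ₁ (σ₂ x)

/-- `σ₁` fixes its mirror. -/
theorem σ₁_of_sum_eq_zero {y : Fin 3 → ℝ} (hy : y 0 + y 1 + y 2 = 0) : σ₁ y = y := by
  funext i; simp [σ₁, hy]

/-- The two linear forms `e_a·(S y)` and `e_b·(S y)` (`e_a = (1,1,0)`, `e_b = (0,0,1)`). -/
theorem S_sum01 (y : Fin 3 → ℝ) : S y 0 + S y 1 = -(7 / 9) * (y 0 + y 1) - 8 / 9 * y 2 := by
  simp [S, σ₁, σ₂]; ring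

/-- See `S_sum01`. -/
theorem S_two (y : Fin 3 → ℝ) : S y 2 = 4 / 9 * (y 0 + y 1) - 7 / 9 * y 2 := by
  simp [S, σ₁, σ₂]; ring

/-! ## The integer sequences -/

/-- `(A, B)_{k+1} = (−7A_k + 4B_k, −8A_k − 7B_k)`, `(A, B)₀ = (1, 1)`: coordinates of `9^k (σ₂σ₁)^k (1,1,1)` in the basis `(1,1,0), (0,0,1)`. -/
def AB : ℕ → ℤ × ℤ
  | 0 => (1, 1)
  | k + 1 => (-7 * (AB k).1 + 4 * (AB k).2, -8 * (AB k).1 - 7 * (AB k).2)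

/-- First coordinate sequence. -/
def A (k : ℕ) : ℤ := (AB k).1

/-- Second coordinate sequence. -/
def B (k : ℕ) : ℤ := (AB k).2

/-- `A₀ = 1`. -/
@[simp] theorem A_zero : A 0 = 1 := rfl

/-- `B₀ = 1`. -/
@[simp] theorem B_zero : B 0 = 1 := rfl

/-- The recurrence for `A`. -/
theorem A_succ (k : ℕ) : A (k + 1) = -7 * A k + 4 * B k := rfl

/-- The recurrence for `B`. -/
theorem B_succ (k : ℕ) : B (k + 1) = -8 * A k - 7 * B k := rfl

/-- The Lucas-type sequence `U₀ = 0, U₁ = 1, U_{m+2} = −14U_{m+1} − 81U_m` (characteristic polynomial of `9·(σ₂σ₁)|_{(1,−1,0)^⊥}`). -/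
def U : ℕ → ℤ
  | 0 => 0
  | 1 => 1
  | m + 2 => -14 * U (m + 1) - 81 * U m

/-- The recurrence for `U`. -/
theorem U_succ_succ (m : ℕ) : U (m + 2) = -14 * U (m + 1) - 81 * U m := rfl

/-- Cayley–Hamilton for `A`. -/
theorem A_rec (k : ℕ) : A (k + 2) = -14 * A (k + 1) - 81 * A k := by
  rw [A_succ (k + 1), A_succ k, B_succ k]; ring

/-- Cayley–Hamilton for `B`. -/
theorem B_rec (k : ℕ) : B (k + 2) = -14 * B (k + 1) - 81 * B k := by
  rw [B_succ (k + 1), A_succ k, B_succ k]; ring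

/-- `A_k − B_k = 12 U_k`. -/
theorem A_sub_B (k : ℕ) : A k - B k = 12 * U k := by
  suffices h : ∀ k, A k - B k = 12 * U k ∧ A (k + 1) - B (k + 1) = 12 * U (k + 1) from (h k).1
  intro k
  induction k with
  | zero => exact ⟨by simp [U], by rw [A_succ, B_succ]; simp [U]⟩
  | succ k ih =>
    refine ⟨ih.2, ?_⟩
    rw [A_rec, B_rec, U_succ_succ]
    linear_combination (-14 : ℤ) * ih.2 - 81 * ih.1

/-- `U_m ≡ 1 (mod 3)` for `m ≥ 1`. -/
theorem U_mod_three (m : ℕ) : ∃ c : ℤ, U (m + 1) = 3 * c + 1 := by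
  suffices h : ∀ m, (∃ c : ℤ, U (m + 1) = 3 * c + 1) ∧ ∃ c : ℤ, U (m + 2) = 3 * c + 1 from (h m).1
  intro m
  induction m with
  | zero => exact ⟨⟨0, by simp [U]⟩, ⟨-5, by simp [U]⟩⟩
  | succ m ih =>
    obtain ⟨⟨c, hc⟩, ⟨c', hc'⟩⟩ := ih
    refine ⟨⟨c', hc'⟩, ⟨-14 * c' - 27 * U (m + 1) - 5, ?_⟩⟩
    rw [show m + 1 + 2 = (m + 1) + 2 from rfl, U_succ_succ, show m + 1 + 1 = m + 2 from rfl, hc']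
    ring

/-- `U_m ≠ 0` for `m ≥ 1`. -/
theorem U_ne_zero {m : ℕ} (hm : 1 ≤ m) : U m ≠ 0 := by
  obtain ⟨k, rfl⟩ := Nat.exists_eq_add_of_le' hm
  obtain ⟨c, hc⟩ := U_mod_three k
  omega

/-- The determinant identity `A_{i+j} B_j − A_j B_{i+j} = 81^j (A_i − B_i)` (the planes `k = i + j` and `j` are `(σ₂σ₁)^j`-images of the planes
`i` and `0`, and `det(9σ₂σ₁|_{f^⊥}) = 81`). -/
theorem det_identity (i j : ℕ) : A (i + j) * B j - A j * B (i + j) = 81 ^ j * (A i - B i) := by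
  induction j with
  | zero => simp
  | succ j ih =>
    rw [show i + (j + 1) = (i + j) + 1 from rfl, A_succ, B_succ, A_succ, B_succ, pow_succ]
    linear_combination (81 : ℤ) * ih

/-- The normals are pairwise non-parallel: `A_k B_j ≠ A_j B_k` for `j < k`. -/
theorem det_ne_zero {j k : ℕ} (hjk : j < k) : A k * B j - A j * B k ≠ 0 := by
  obtain ⟨i, rfl⟩ := Nat.exists_eq_add_of_lt hjk
  rw [show j + i + 1 = (i + 1) + j by ring, det_identity, A_sub_B]
  exact mul_ne_zero (pow_ne_zero _ (by norm_num)) (mul_ne_zero (by norm_num) (U_ne_zero (by omega)))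

/-- `A_k` and `A_{k+1}` never vanish together. -/
theorem A_ne_zero_or (k : ℕ) : A k ≠ 0 ∨ A (k + 1) ≠ 0 := by
  by_cases h0 : A k = 0
  · right
    intro h1
    have := det_ne_zero (Nat.lt_succ_self k)
    rw [h0, h1] at this
    simp at this
  · exact Or.inl h0

/-- Hence `{k | A_k ≠ 0}` is infinite. -/
theorem infinite_A_ne_zero : {k : ℕ | A k ≠ 0}.Infinite := by
  refine Set.infinite_of_forall_exists_gt fun m => ?_
  rcases A_ne_zero_or (m + 1) with h | h
  · exact ⟨m + 1, h, Nat.lt_succ_self m⟩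
  · exact ⟨m + 2, h, by omega⟩

/-! ## The planes `(σ₂σ₁)^k Π₁` -/

/-- `n·(S^k y) = (A_k (y₀ + y₁) + B_k y₂) / 9^k`. -/
theorem sum_iterate_S (k : ℕ) (y : Fin 3 → ℝ) :
    (S^[k] y) 0 + (S^[k] y) 1 + (S^[k] y) 2 = ((A k : ℝ) * (y 0 + y 1) + (B k : ℝ) * y 2) / 9 ^ k := by
  induction k generalizing y with
  | zero => simp
  | succ k ih =>
    rw [Function.iterate_succ_apply, ih (S y), S_sum01, S_two, A_succ, B_succ]
    push_cast
    field_simp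
    ring

variable {P : MvPolynomial (Fin 3) ℝ}

/-- `P∘σ₁ = −P` ⇒ `P` vanishes on the mirror `Π₁`. -/
theorem eval_eq_zero_of_sum_eq_zero (h₁ : ∀ x, eval (σ₁ x) P = -eval x P) {y : Fin 3 → ℝ} (hy : y 0 + y 1 + y 2 = 0) :
    eval y P = 0 := by
  have h := h₁ y
  rw [σ₁_of_sum_eq_zero hy] at h
  linarith

/-- `P∘σ₁ = −P`, `P∘σ₂ = −P` ⇒ `P∘S = P`, `S = σ₁σ₂`. -/
theorem eval_S (h₁ : ∀ x, eval (σ₁ x) P = -eval x P) (h₂ : ∀ x, eval (σ₂ x) P = -eval x P) (x : Fin 3 → ℝ) :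
    eval (S x) P = eval x P := by
  rw [S, h₁, h₂, neg_neg]

/-- … hence `P∘S^k = P`. -/
theorem eval_iterate_S (h₁ : ∀ x, eval (σ₁ x) P = -eval x P) (h₂ : ∀ x, eval (σ₂ x) P = -eval x P) (k : ℕ) (x : Fin 3 → ℝ) :
    eval (S^[k] x) P = eval x P := by
  induction k generalizing x with
  | zero => simp
  | succ k ih => rw [Function.iterate_succ_apply, ih, eval_S h₁ h₂]

/-- `P` vanishes on the `k`-th plane `{A_k(y₀+y₁) + B_k y₂ = 0}`. -/
theorem eval_eq_zero_of_plane (h₁ : ∀ x, eval (σ₁ x) P = -eval x P) (h₂ : ∀ x, eval (σ₂ x) P = -eval x P) (k : ℕ)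
    {y : Fin 3 → ℝ} (hy : (A k : ℝ) * (y 0 + y 1) + (B k : ℝ) * y 2 = 0) : eval y P = 0 := by
  rw [← eval_iterate_S h₁ h₂ k y]
  refine eval_eq_zero_of_sum_eq_zero h₁ ?_
  rw [sum_iterate_S, hy, zero_div]

/-! ## The univariate restriction and the kill -/

/-- Restriction of `P` to the line `x + t·(1,1,0)` as a univariate polynomial. -/
def lineRestrict (P : MvPolynomial (Fin 3) ℝ) (x : Fin 3 → ℝ) : Polynomial ℝ :=
  MvPolynomial.aeval (fun i : Fin 3 => Polynomial.C (x i) + Polynomial.C (if i = 2 then (0 : ℝ) else 1) * Polynomial.X) P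

/-- Evaluation of the restriction. -/
theorem eval_lineRestrict (P : MvPolynomial (Fin 3) ℝ) (x : Fin 3 → ℝ) (t : ℝ) :
    (lineRestrict P x).eval t = eval (fun i => x i + (if i = 2 then (0 : ℝ) else 1) * t) P := by
  set g : Fin 3 → Polynomial ℝ :=
    fun i => Polynomial.C (x i) + Polynomial.C (if i = 2 then (0 : ℝ) else 1) * Polynomial.X with hg
  calc (lineRestrict P x).eval t = Polynomial.aeval t (lineRestrict P x) :=
        (congrFun (Polynomial.coe_aeval_eq_eval t) (lineRestrict P x)).symm
    _ = MvPolynomial.aeval (fun i => Polynomial.aeval t (g i)) P := MvPolynomial.comp_aeval_apply (f := g) _ P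
    _ = MvPolynomial.aeval (fun i => x i + (if i = 2 then (0 : ℝ) else 1) * t) P := by
        have hfun : (fun i => Polynomial.aeval t (g i)) = fun i => x i + (if i = 2 then (0 : ℝ) else 1) * t := by
          funext i
          by_cases hi : i = 2 <;> simp [hg, hi]
        rw [hfun]
    _ = eval (fun i => x i + (if i = 2 then (0 : ℝ) else 1) * t) P :=
        congrFun (MvPolynomial.aeval_eq_eval (f := fun i => x i + (if i = 2 then (0 : ℝ) else 1) * t)) P

/-- **Main lemma, off the plane `x₂ = 0`.** -/
theorem eval_eq_zero_of_ne (h₁ : ∀ x, eval (σ₁ x) P = -eval x P) (h₂ : ∀ x, eval (σ₂ x) P = -eval x P)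
    {x : Fin 3 → ℝ} (hx : x 2 ≠ 0) : eval x P = 0 := by
  -- the meeting parameters
  set t : ℕ → ℝ := fun k => -(x 0 + x 1) / 2 - (B k : ℝ) * x 2 / (2 * A k) with ht
  have hroot : ∀ k : ℕ, A k ≠ 0 → (lineRestrict P x).IsRoot (t k) := by
    intro k hk
    have hk' : (A k : ℝ) ≠ 0 := by exact_mod_cast hk
    rw [Polynomial.IsRoot, eval_lineRestrict]
    refine eval_eq_zero_of_plane h₁ h₂ k ?_
    simp only [Fin.isValue, Fin.reduceEq, ↓reduceIte, one_mul, zero_mul, add_zero]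
    rw [ht]
    field_simp
    ring
  have hinj : Set.InjOn t {k : ℕ | A k ≠ 0} := by
    intro k hk j hj hkj
    have hk' : (A k : ℝ) ≠ 0 := by exact_mod_cast (show A k ≠ 0 from hk)
    have hj' : (A j : ℝ) ≠ 0 := by exact_mod_cast (show A j ≠ 0 from hj)
    rw [ht] at hkj
    dsimp only at hkj
    have hcross : (A j : ℝ) * B k = A k * B j := by
      have : (B k : ℝ) * x 2 / (2 * A k) = (B j : ℝ) * x 2 / (2 * A j) := by linarith
      field_simp at this
      -- this : B k * x 2 * (2 * A j) = B j * x 2 * (2 * A k)  (up to normal form)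
      have h2 : x 2 * 2 ≠ 0 := by positivity
      nlinarith [mul_self_pos.2 hx, this]
    have hcrossZ : A j * B k = A k * B j := by exact_mod_cast hcross
    by_contra hne
    rcases lt_or_gt_of_ne hne with hlt | hlt
    · exact det_ne_zero hlt (by linarith [hcrossZ])
    · exact det_ne_zero hlt (by linarith [hcrossZ])
  have hinf : {s : ℝ | (lineRestrict P x).IsRoot s}.Infinite := by
    refine Set.Infinite.mono ?_ ((Set.infinite_image_iff hinj).2 infinite_A_ne_zero)
    rintro s ⟨k, hk, rfl⟩
    exact hroot k hk
  have hzero : lineRestrict P x = 0 := Polynomial.eq_zero_of_infinite_isRoot _ hinf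
  have h0 := eval_lineRestrict P x 0
  rw [hzero, Polynomial.eval_zero] at h0
  simp only [mul_zero, add_zero] at h0
  exact h0.symm

/-- **THEOREM.** A real polynomial in three variables that is odd under the two reflections `σ₁` (in `(1,1,1)^⊥`) and `σ₂` (in `(1,1,−1)^⊥`)
is zero. [folklore] -/
theorem eq_zero_of_odd_under_two_diagonal_reflections (P : MvPolynomial (Fin 3) ℝ)
    (h₁ : ∀ x, eval (σ₁ x) P = -eval x P) (h₂ : ∀ x, eval (σ₂ x) P = -eval x P) : P = 0 := by
  refine MvPolynomial.funext fun x => ?_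
  rw [map_zero]
  by_cases hx : x 2 = 0
  swap
  · exact eval_eq_zero_of_ne h₁ h₂ hx
  · -- continuity across the plane `x₂ = 0`
    set e : Fin 3 → ℝ := fun i => if i = 2 then 1 else 0 with he
    have hseq : ∀ n : ℕ, eval (x + (1 / ((n : ℝ) + 1)) • e) P = 0 := by
      intro n
      refine eval_eq_zero_of_ne h₁ h₂ ?_
      simp [he, hx]
      positivity
    have hlim : Tendsto (fun n : ℕ => x + (1 / ((n : ℝ) + 1)) • e) atTop (𝓝 x) := by
      have h1 : Tendsto (fun n : ℕ => (1 / ((n : ℝ) + 1)) • e) atTop (𝓝 ((0 : ℝ) • e)) :=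
        tendsto_one_div_add_atTop_nhds_zero_nat.smul_const e
      rw [zero_smul] at h1
      simpa using tendsto_const_nhds.add h1
    have hcont : Continuous fun y : Fin 3 → ℝ => eval y P := MvPolynomial.continuous_eval P
    have h2 : Tendsto (fun n : ℕ => eval (x + (1 / ((n : ℝ) + 1)) • e) P) atTop (𝓝 (eval x P)) :=
      (hcont.tendsto x).comp hlim
    have h3 : Tendsto (fun n : ℕ => eval (x + (1 / ((n : ℝ) + 1)) • e) P) atTop (𝓝 0) := by
      simp only [hseq]; exact tendsto_const_nhds
    exact tendsto_nhds_unique h2 h3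

/-- The same statement with the hypotheses as polynomial identities for the pulled-back polynomials is immediate from the function form;
we also record the corollary used in §1 step (7) of `TrigonalInjectivity.md`: odd under `σ₁` and invariant under `σ₁σ₂` suffices. -/
theorem eq_zero_of_odd_and_invariant (P : MvPolynomial (Fin 3) ℝ)
    (h₁ : ∀ x, eval (σ₁ x) P = -eval x P) (hS : ∀ x, eval (S x) P = eval x P) : P = 0 := by
  refine eq_zero_of_odd_under_two_diagonal_reflections P h₁ fun x => ?_
  have h := hS x
  rw [S, h₁] at h
  linarith

end Summit.QuantumFields.YangMills.Theorems.F4SubCurvatureDoorTwoReflections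

end
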